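import Mathlib
import HarnessLib

/-!
# The PNT-kernel decay rate: the root of `κ·tanh(κa) = ½` above `½` exists, is unique, and is the infimum defining `pntKappa`

Helper file (`--supports stmt-RiemannHypothesis-0098`, lead-track anchor: Weil-positivity window ladder, format-C far bound),
RH-free, pure real analysis (Mathlib only).  Seat rh-explicit-weil-1 gen8 (memo
`run/shared/lean/pub/rh-explicit/rh-explicit-weil-1/FORMAT-K3.md` §9.12).

`WeilFarCoercivityFloor` defines the floor law's decay rate by description, `pntKappa a := sInf {κ | ½ < κ ∧ ½ ≤ κ·tanh(κa)}`
(STRUCTURE.md C-XIII: `L(a) = 1/(κ² − ¼)` is the top eigenvalue of the PNT kernel `e^{|x−y|/2}` on `[−a, a]`, cf.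
`WeilFarFloorOrder` §2).  This file proves, for every `a > 0` and WITHOUT importing the (unbuilt) floor file, everything about
that infimum: with `φ_a(κ) = 2κ·sinh(κa) − cosh(κa)` (`hasDerivAt_pntPsi`), `φ_a` is strictly increasing on `[½, ∞)`
(`pntPsi_strictMonoOn`), `φ_a(½) < 0 < φ_a(1 + 1/a)` (`pntPsi_half_neg`, `pntPsi_big_pos`), so by the intermediate value
theorem the set is `[κ*, ∞)` for the unique root `κ*`, and
`sInf_pntKappaSet_spec : ½ < sInf S ∧ sInf S · sinh(sInf S · a) = cosh(sInf S · a)/2`.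
The one-line corollaries for `pntKappa`/`pntFloor` (root, closed form `e^{2κa}/(κ+½)²`, eigenfunction, `e^a ≤ L(a) ≤ e^a + 4a`)
are staged in `WeilFarCoercivityFloorKappa` and land when the floor file's olean exists.  Standard axioms only.
-/

set_option linter.dupNamespace false
set_option autoImplicit false

noncomputable section

open Set

namespace Summit.RiemannHypothesis.RiemannHypothesis.Theorems.WeilFormatC.FloorGrowth

/-! ### The root of `2κ·sinh(κa) = cosh(κa)` above `½` -/

/-- The defining equation in polynomial-free form: `ψ_a(κ) = 2κ·sinh(κa) − cosh(κa)`. -/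
theorem hasDerivAt_pntPsi (a κ : ℝ) :
    HasDerivAt (fun κ ↦ 2 * κ * Real.sinh (κ * a) - Real.cosh (κ * a))
      (2 * Real.sinh (κ * a) + 2 * κ * (Real.cosh (κ * a) * a) - Real.sinh (κ * a) * a) κ := by
  have hk : HasDerivAt (fun κ ↦ κ * a) a κ := by simpa using (hasDerivAt_id' κ).mul_const a
  have hs := hk.sinh
  have hc := hk.cosh
  have h1 : HasDerivAt (fun κ ↦ 2 * κ) 2 κ := by simpa using (hasDerivAt_id' κ).const_mul (2 : ℝ)
  have h2 := h1.mul hs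
  exact h2.sub hc

/-- For `a > 0` the function `ψ_a` is strictly increasing on `[1/2, ∞)`. -/
theorem pntPsi_strictMonoOn {a : ℝ} (ha : 0 < a) :
    StrictMonoOn (fun κ ↦ 2 * κ * Real.sinh (κ * a) - Real.cosh (κ * a)) (Ici (1 / 2 : ℝ)) := by
  refine strictMonoOn_of_deriv_pos (convex_Ici _) ?_ ?_
  · exact (HasDerivAt.continuousOn fun κ _ ↦ hasDerivAt_pntPsi a κ)
  · intro κ hκ
    rw [interior_Ici, Set.mem_Ioi] at hκ
    rw [(hasDerivAt_pntPsi a κ).deriv]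
    have hκa : 0 < κ * a := by nlinarith
    have hsinh : 0 < Real.sinh (κ * a) := Real.sinh_pos_iff.2 hκa
    have hcs : Real.sinh (κ * a) < Real.cosh (κ * a) := Real.sinh_lt_cosh _
    nlinarith [mul_pos (sub_pos.2 hκ) (mul_pos ha (Real.cosh_pos (κ * a))), mul_pos ha (sub_pos.2 hcs), hsinh]

/-- `ψ_a(1/2) < 0`. -/
theorem pntPsi_half_neg (a : ℝ) : 2 * (1 / 2 : ℝ) * Real.sinh (1 / 2 * a) - Real.cosh (1 / 2 * a) < 0 := by
  have := Real.sinh_lt_cosh (1 / 2 * a); linarith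

/-- `ψ_a(1 + 1/a) > 0` for `a > 0` (`2 sinh t ≥ cosh t` once `e^{2t} ≥ 3`, here `t = a + 1 ≥ 1`). -/
theorem pntPsi_big_pos {a : ℝ} (ha : 0 < a) :
    0 < 2 * (1 + 1 / a) * Real.sinh ((1 + 1 / a) * a) - Real.cosh ((1 + 1 / a) * a) := by
  have ht : (1 + 1 / a) * a = a + 1 := by field_simp
  rw [ht, Real.sinh_eq, Real.cosh_eq]
  have h1 : Real.exp 1 ≤ Real.exp (a + 1) := Real.exp_le_exp.2 (by linarith)
  have he := Real.exp_one_gt_d9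
  have hneg : Real.exp (-(a + 1)) ≤ Real.exp (-1) := Real.exp_le_exp.2 (by linarith)
  have hn1 := Real.exp_neg_one_lt_d9
  have hpos : 0 < Real.exp (-(a + 1)) := Real.exp_pos _
  have h1a : 0 < 1 / a := by positivity
  nlinarith

/-- **The PNT decay rate is a genuine root**: for `a > 0`, `κ* := sInf {κ | 1/2 < κ ∧ 1/2 ≤ κ tanh(κa)}` satisfies
`1/2 < κ*` and `κ*·sinh(κ* a) = cosh(κ* a)/2` (i.e. `κ* tanh(κ* a) = 1/2`). -/
theorem sInf_pntKappaSet_spec {a : ℝ} (ha : 0 < a) :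
    1 / 2 < sInf {κ : ℝ | 1 / 2 < κ ∧ 1 / 2 ≤ κ * Real.tanh (κ * a)} ∧
      sInf {κ : ℝ | 1 / 2 < κ ∧ 1 / 2 ≤ κ * Real.tanh (κ * a)} *
          Real.sinh (sInf {κ : ℝ | 1 / 2 < κ ∧ 1 / 2 ≤ κ * Real.tanh (κ * a)} * a)
        = Real.cosh (sInf {κ : ℝ | 1 / 2 < κ ∧ 1 / 2 ≤ κ * Real.tanh (κ * a)} * a) / 2 := by
  set S := {κ : ℝ | 1 / 2 < κ ∧ 1 / 2 ≤ κ * Real.tanh (κ * a)} with hS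
  set φ : ℝ → ℝ := fun κ ↦ 2 * κ * Real.sinh (κ * a) - Real.cosh (κ * a) with hφ
  -- membership in S ⇔ κ > 1/2 ∧ ψ κ ≥ 0
  have hmem : ∀ κ : ℝ, κ ∈ S ↔ 1 / 2 < κ ∧ 0 ≤ φ κ := by
    intro κ
    simp only [hS, mem_setOf_eq, hφ]
    have hc : 0 < Real.cosh (κ * a) := Real.cosh_pos _
    rw [Real.tanh_eq_sinh_div_cosh, ← mul_div_assoc, le_div_iff₀ hc]
    constructor
    · rintro ⟨h1, h2⟩; exact ⟨h1, by linarith⟩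
    · rintro ⟨h1, h2⟩; exact ⟨h1, by linarith⟩
  have hcont : Continuous φ := by rw [hφ]; fun_prop
  have h1a : 0 < 1 / a := one_div_pos.2 ha
  have hK : (1 / 2 : ℝ) ≤ 1 + 1 / a := by linarith
  have hlo : φ (1 / 2) < 0 := pntPsi_half_neg a
  have hhi : 0 < φ (1 + 1 / a) := pntPsi_big_pos ha
  obtain ⟨κ₀, hκ₀mem, hκ₀⟩ : ∃ κ₀ ∈ Icc (1 / 2 : ℝ) (1 + 1 / a), φ κ₀ = 0 :=
    intermediate_value_Icc hK hcont.continuousOn ⟨hlo.le, hhi.le⟩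
  have hκ₀gt : 1 / 2 < κ₀ := by
    rcases eq_or_lt_of_le hκ₀mem.1 with h | h
    · rw [← h] at hκ₀; linarith
    · exact h
  have hmono := pntPsi_strictMonoOn ha
  have hleast : IsLeast S κ₀ := by
    refine ⟨(hmem κ₀).2 ⟨hκ₀gt, hκ₀.ge⟩, fun κ hκ ↦ ?_⟩
    obtain ⟨hκgt, hψκ⟩ := (hmem κ).1 hκ
    by_contra hlt
    push Not at hlt
    have hlt' := hmono (show κ ∈ Ici (1 / 2 : ℝ) from hκgt.le) (show κ₀ ∈ Ici (1 / 2 : ℝ) from hκ₀mem.1) hlt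
    have hψκ' : 0 ≤ 2 * κ * Real.sinh (κ * a) - Real.cosh (κ * a) := hψκ
    have hκ₀' : 2 * κ₀ * Real.sinh (κ₀ * a) - Real.cosh (κ₀ * a) = 0 := hκ₀
    simp only at hlt'
    linarith
  rw [hleast.csInf_eq]
  refine ⟨hκ₀gt, ?_⟩
  have hκ₀' : 2 * κ₀ * Real.sinh (κ₀ * a) - Real.cosh (κ₀ * a) = 0 := hκ₀
  linarith

end Summit.RiemannHypothesis.RiemannHypothesis.Theorems.WeilFormatC.FloorGrowth
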